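import Literature.Probability.Percolation.ZdLowestFrontier
import Literature.Probability.Percolation.ZdFourArmSepInwardExt
import HarnessLib

/-!
# Catching the tip of the lowest crossing: fence and upper extent from crossings around it

Topic `Literature/Probability/Percolation`; bond percolation on `ℤ² = Site 2`. PROOFS ONLY (no
definition, no named fact).  A brick of the EXTERNAL per-scale lemma of Kesten's arm-separation
theorem for bond percolation on `ℤ²` (H. Kesten, CMP 109 (1987), §2, Lemma 4; P. Nolin, EJP 13
(2008), §4.4, Lemma 15 [arXiv 0711.4948: Lemma 14]: around the extremity `z_u` of the lowest
crossing `c_u`, "by considering a black circuit in the annuli `S_{2^{l-1},2^l}(z_u)` … we can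
construct a small extension of `c_u`"; O. Schramm, J. Steif, Ann. Math. 171 (2010), App. A,
Lemma A.2: "there is a white crossing in `Y_i ∖ B(z_i, δR)` from `∂β̂_i` to `∂H_R`" in the
unbiased region beyond the `i`-th interface), in the tree's language of the LOWEST OPEN
LEFT–RIGHT CROSSING of a rectangle `R = [0,M] × [0,N]` (`ZdLowestFrontier.lean`: the path
`Λ : LowPath M N ω₀`, its right end `Λ.b` = the TIP, the vertices above it `IsAboveVertex`).

Let `z = Λ.b = (M, z₁)` be the tip of the lowest crossing of `R` in a lattice configuration `ω₀`,
with `2ρ ≤ z₁`, `z₁ + 2ρ ≤ N`, `2ρ ≤ M`, `ρ ≥ 1`.  Suppose a second lattice configuration `ω`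
has, in the square annulus of scale `ρ` around `z`, three open rectangle crossings: left–right
crossings `H⁺` of `[M-2ρ, M+2ρ] × [z₁+ρ, z₁+2ρ]` and `H⁻` of `[M-2ρ, M+2ρ] × [z₁-2ρ, z₁-ρ]` and a
top–bottom crossing `V^L` of `[M-2ρ, M-ρ] × [z₁-2ρ, z₁+2ρ]`; and let `V` be any lattice walk
inside the columns `[M+ρ, M+2ρ]` (outside `R`) from a row `≤ z₁+ρ` to a row `≥ z₁+2ρ` — in the
application, an open top–bottom crossing of `[M+ρ, M+2ρ] × [z₁-3ρ, z₁+3ρ]`, the future FENCE of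
the arm.  Then (`LowPath.exists_tipCatch`) some vertex `u` of `V` is joined to a vertex `v` of the
lowest crossing by an `ω`-open walk `P` inside the square `[M-2ρ, M+2ρ] × [z₁-2ρ, z₁+2ρ]` such that

* all vertices of `P` but `v` lie OUTSIDE `R` (to the right of it) or are ABOVE VERTICES of the
  lowest crossing of `ω₀` — `P` uses only "fresh" edges, whose states are not read by the event
  "the lowest crossing is `Λ`";
* every vertex of `P` on the right side of `R` has height `≥ z₁ + ρ` (UPPER EXTENT: through `P`,
  the open cluster of `Λ` in `R` reaches the right side at height `≥ z₁ + ρ`).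

The proof is a planar case analysis (`LowPath.fresh_chain`): `H⁺` meets `V` (fence lemma) and,
followed leftwards, enters `R` through the right side strictly above the tip, where every vertex
is an above vertex (`LowPath.isAboveVertex_right`: the faces of the right column above the tip
are above faces, for otherwise the edge between the last below face and the first above face of
that column would be a low edge, i.e. an edge of `Λ` at a second right-side vertex of `Λ` — but
`Λ` meets the right side only at its tip, `LowPath.apply_zero_lt_of_ne`); a neighbour in `R` of
an above vertex is above or on `Λ` (`IsAboveVertex.of_adj`), so each of the open walks `H⁺`
(leftwards), then `V^L` (downwards, from its junction with `H⁺`), then `H⁻` (rightwards, from its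
junction with `V^L`) either hits `Λ` or consists of above vertices; and `H⁻` cannot stay above up
to its first visit of the right side, which happens strictly BELOW the tip, where no vertex is
above (`LowPath.not_isAboveVertex_right_of_lt`).  The two configurations `ω₀` (defining the
lowest crossing) and `ω` (carrying the crossings) are unrelated: downstream, `ω₀` is the
restriction of the percolation configuration to one crossing cluster and `ω` is the percolation
configuration with the non-fresh edges opened.

## References

* H. Kesten, *Scaling relations for 2D-percolation*, CMP 109 (1987), §2, Lemma 4
  [KestenScalingCMP1987].
* P. Nolin, *Near-critical percolation in two dimensions*, EJP 13 (2008), §4.4, Lemma 15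
  (arXiv 0711.4948: Lemma 14, p. 11) [Nolin2008].
* O. Schramm, J. Steif, *Quantitative noise sensitivity and exceptional times for percolation*,
  Ann. Math. 171 (2010), Appendix A, Lemma A.2 (arXiv math/0504586, p. 26) [SchrammSteif2010].
* H. Kesten, *Percolation theory for mathematicians* (1982), §2.2–2.3 [KestenPTM1982].

## Tree

`LowPath`, `IsLowEdge`, `IsLowVertex`, `IsAboveVertex`, `IsAboveFace`, `dualBelowR`,
`IsAboveVertex.of_adj`, `IsAboveVertex.isAboveFace_of_corner`, `LowPath.mem_support_iff`
(`ZdLowestFrontier.lean`); `ZdDual.sep_cases` (`ZdFiveArmColumnDefs.lean`); `cornerFaces`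
(`ZdFiveArmUniqueness.lean`); surgery `exists_prefix_reach_ge(_sharp)`, `exists_segment_between`,
`exists_mem_support_of_vFence` (`ZdFiveArmSeparatedGluing.lean`, `ZdFourArmSepInwardExt.lean`);
`lrCrossingAt`, `tbCrossingAt'`, `exists_walk_of_mem_lrCrossingAt`, `exists_walk_of_mem_tbCrossingAt`.
-/

noncomputable section

open SimpleGraph Finset

namespace Literature.Probability.Percolation

open LatticeModels

variable {M N : ℕ} {ω₀ ω : BondConfig (Site 2)}

/-! ### Low edges at the right side -/

/-- **A low edge at a right-side vertex is the horizontal edge entering it from the left**: the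
two faces of a low edge lie in `R* = [0, M-1] × [-1, N]`, so the edge is not on the line
`x₀ = M`. [folklore] -/
theorem IsLowEdge.eq_of_mem_of_apply_zero_eq {e : Sym2 (Site 2)} (h : IsLowEdge M N ω₀ e) {w : Site 2}
    (hw : w ∈ e) (hw0 : w 0 = M) : e = s(w - Pi.single 0 1, w) := by
  obtain ⟨g, f, hgf, hg, hf, rfl⟩ := h
  have hgR := mem_dualRectangle_iff.1 (dualBelowR_subset hg)
  have hfR := mem_dualRectangle_iff.1 hf.mem_dualRectangle
  rw [sepEdge, Sym2.mem_iff] at hw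
  rw [sepEdge]
  rcases ZdDual.sep_cases hgf with ⟨h0, h1, hlo0, hlo1, hhi0, hhi1⟩ | ⟨h0, h1, hlo0, hlo1, hhi0, hhi1⟩ |
      ⟨h1, h0, hlo0, hlo1, hhi0, hhi1⟩ | ⟨h1, h0, hlo0, hlo1, hhi0, hhi1⟩
  · rcases hw with rfl | rfl <;> omega
  · rcases hw with rfl | rfl <;> omega
  · -- vertical step `g → f = g + e₁`: the edge is horizontal at height `g₁ + 1`
    rcases hw with rfl | rfl
    · omega
    · refine Sym2.eq_iff.2 (Or.inl ⟨?_, rfl⟩)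
      rw [Site.eq_iff_two]
      simp only [Pi.sub_apply, single_zero_apply_zero, single_zero_apply_one]
      omega
  · rcases hw with rfl | rfl
    · omega
    · refine Sym2.eq_iff.2 (Or.inl ⟨?_, rfl⟩)
      rw [Site.eq_iff_two]
      simp only [Pi.sub_apply, single_zero_apply_zero, single_zero_apply_one]
      omega

namespace LowPath

variable (Λ : LowPath M N ω₀)

/-- **The lowest crossing meets the right side only at its tip**: every other vertex of it has
`x₀ < M` (an interior vertex on the right side would carry two distinct low edges, both equal to
the horizontal edge entering it). [folklore] -/
theorem apply_zero_lt_of_ne (hM : 1 ≤ M) {w : Site 2} (hw : w ∈ Λ.path.support) (hne : w ≠ Λ.b) :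
    w 0 < M := by
  have hwR : w ∈ rectangle M N := Λ.mem_rectangle w hw
  have hw0 : w 0 ≤ M := (mem_rectangle_iff.1 hwR).2.1
  rcases hw0.lt_or_eq with h | h
  · exact h
  exfalso
  obtain ⟨i, hi, hil⟩ := Walk.mem_support_iff_exists_getVert.1 hw
  rcases Nat.eq_zero_or_pos i with rfl | hi0
  · rw [Walk.getVert_zero] at hi
    have := Λ.left
    rw [← hi] at h; omega
  rcases hil.lt_or_eq with hil' | rfl
  · -- interior vertex: two low edges at `w`, both equal to the edge entering from the left
    have e₁ := Λ.mk_getVert_mem_edges (k := i - 1) (by omega)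
    have e₂ := Λ.mk_getVert_mem_edges (k := i) hil'
    rw [show i - 1 + 1 = i by omega, hi] at e₁
    rw [hi] at e₂
    have h₁ := ((Λ.mem_edges_iff _).1 e₁).eq_of_mem_of_apply_zero_eq (Sym2.mem_mk_right _ _) h
    have h₂ := ((Λ.mem_edges_iff _).1 e₂).eq_of_mem_of_apply_zero_eq (Sym2.mem_mk_left _ _) h
    have hv₁ : Λ.path.getVert (i - 1) = w - Pi.single 0 1 := by
      have hne' : Λ.path.getVert (i - 1) ≠ w := by
        intro heq
        have := Λ.getVert_injective (i := i - 1) (j := i) (by omega) hil (by rw [heq, hi])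
        omega
      rcases Sym2.eq_iff.1 h₁ with ⟨h3, -⟩ | ⟨h3, -⟩
      · exact h3
      · exact absurd h3 hne'
    have hv₂ : Λ.path.getVert (i + 1) = w - Pi.single 0 1 := by
      have hne' : Λ.path.getVert (i + 1) ≠ w := by
        intro heq
        have := Λ.getVert_injective (i := i + 1) (j := i) (by omega) hil (by rw [heq, hi])
        omega
      rcases Sym2.eq_iff.1 h₂ with ⟨-, h4⟩ | ⟨-, h4⟩
      · exact absurd h4 hne'
      · exact h4
    have := Λ.getVert_injective (i := i - 1) (j := i + 1) (by omega) (by omega) (by rw [hv₁, hv₂])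
    omega
  · rw [Walk.getVert_length] at hi
    exact hne hi.symm

/-- The tip is a vertex of the right side of `R`. [folklore] -/
theorem b_mem_rectangle : Λ.b ∈ rectangle M N := Λ.mem_rectangle _ Λ.path.end_mem_support

/-- **The faces of the right column at and above the tip are above faces** (downward induction
from the top face, which is above since no top face lies below; a below face in that column just
under an above one would make the horizontal edge between them a low edge, hence an edge of `Λ`
at a second right-side vertex). [folklore] -/
theorem isAboveFace_rightCol (hM : 1 ≤ M) (hT : ∀ t ∈ dualTopSide M N, t ∉ dualBelowR M N ω₀)
    {y : ℤ} (hy : Λ.b 1 ≤ y) (hyN : y ≤ N) :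
    IsAboveFace M N ω₀ ![(M : ℤ) - 1, y] := by
  have hb := mem_rectangle_iff.1 Λ.b_mem_rectangle
  -- downward induction on `k = N - y`
  obtain ⟨k, rfl⟩ : ∃ k : ℕ, y = (N : ℤ) - k := ⟨(N - y).toNat, by omega⟩
  induction k with
  | zero =>
    have ht : (![(M : ℤ) - 1, (N : ℤ) - ((0 : ℕ) : ℤ)] : Site 2) ∈ dualTopSide M N := by
      refine Finset.mem_filter.2 ⟨mem_dualRectangle_iff.2 ?_, ?_⟩
      · simp; omega
      · simp
    exact isAboveFace_of_mem_dualTopSide ht (hT _ ht)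
  | succ k ih =>
    have ih' := ih (by omega) (by omega)
    set f : Site 2 := ![(M : ℤ) - 1, (N : ℤ) - ((k + 1 : ℕ) : ℤ)] with hf
    set f' : Site 2 := ![(M : ℤ) - 1, (N : ℤ) - (k : ℕ)] with hf'
    have hff' : f' = f + Pi.single 1 1 := by
      rw [Site.eq_iff_two]
      simp only [hf, hf', Pi.add_apply, single_one_apply_zero, single_one_apply_one, Matrix.cons_val_zero,
        Matrix.cons_val_one, Nat.cast_add, Nat.cast_one]
      omega
    have hadj : (zdGraph 2).Adj f f' := by rw [hff']; exact adj_of_stepKind (.up (by simp) (by simp))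
    have hfR : f ∈ dualRectangle M N := by
      rw [mem_dualRectangle_iff]; simp [hf]; omega
    by_cases hfB : f ∈ dualBelowR M N ω₀
    · exfalso
      -- the edge between `f` (below) and `f'` (above) is a low edge at `(M, N - k)`
      have hle : IsLowEdge M N ω₀ (sepEdge f f') := ⟨f, f', hadj, hfB, ih', rfl⟩
      have hmem : (f' + Pi.single 0 1 : Site 2) ∈ sepEdge f f' := by
        rw [hff', sepEdge_up]; exact Sym2.mem_mk_right _ _
      have hv : (f' + Pi.single 0 1 : Site 2) ∈ Λ.path.support :=
        (Λ.mem_support_iff hM).2 ⟨_, hle, hmem⟩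
      have h0 : (f' + Pi.single 0 1 : Site 2) 0 = M := by simp [hf']
      have heq : (f' + Pi.single 0 1 : Site 2) = Λ.b := by
        by_contra hne
        have := Λ.apply_zero_lt_of_ne hM hv hne
        omega
      have h1 : (f' + Pi.single 0 1 : Site 2) 1 = (N : ℤ) - k := by simp [hf']
      rw [heq] at h1
      omega
    · exact ih'.of_adj hadj.symm hfR hfB

/-- **Right-side vertices strictly above the tip are above vertices.** [folklore] -/
theorem isAboveVertex_right (hM : 1 ≤ M) (hT : ∀ t ∈ dualTopSide M N, t ∉ dualBelowR M N ω₀)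
    {w : Site 2} (hw0 : w 0 = M) (hy : Λ.b 1 < w 1) (hyN : w 1 ≤ N) :
    IsAboveVertex M N ω₀ w := by
  have hb := mem_rectangle_iff.1 Λ.b_mem_rectangle
  refine ⟨mem_rectangle_iff.2 ⟨by omega, by omega, by omega, hyN⟩, fun hl => ?_, ?_⟩
  · have hw : w ∈ Λ.path.support := (Λ.mem_support_iff hM).2 hl
    have : w = Λ.b := by
      by_contra hne; have := Λ.apply_zero_lt_of_ne hM hw hne; omega
    rw [this] at hy; omega
  · refine ⟨w - Pi.single 0 1 - Pi.single 1 1, ZdCorner.SW_mem w, ?_⟩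
    have : (w - Pi.single 0 1 - Pi.single 1 1 : Site 2) = ![(M : ℤ) - 1, w 1 - 1] := by
      ext i; fin_cases i <;> simp [hw0]
    rw [this]
    exact Λ.isAboveFace_rightCol hM hT (by omega) (by omega)

/-- The face of the right column just below the tip is a below face (the edge entering the tip
from the left separates it from the above face just above it). [folklore] -/
theorem mem_dualBelowR_below_tip (hM : 1 ≤ M) (hT : ∀ t ∈ dualTopSide M N, t ∉ dualBelowR M N ω₀) :
    (![(M : ℤ) - 1, Λ.b 1 - 1] : Site 2) ∈ dualBelowR M N ω₀ := by
  have hb := mem_rectangle_iff.1 Λ.b_mem_rectangle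
  -- the low edge at the tip
  obtain ⟨e, he, hbe⟩ : IsLowVertex M N ω₀ Λ.b := (Λ.mem_support_iff hM).1 Λ.path.end_mem_support
  obtain ⟨g, f, hgf, hg, hf, rfl⟩ := he
  have heq := (show IsLowEdge M N ω₀ (sepEdge g f) from ⟨g, f, hgf, hg, hf, rfl⟩).eq_of_mem_of_apply_zero_eq hbe Λ.right
  -- name the two candidate faces
  set lo : Site 2 := ![(M : ℤ) - 1, Λ.b 1 - 1] with hlo
  set hi : Site 2 := ![(M : ℤ) - 1, Λ.b 1] with hhi
  have hhilo : hi = lo + Pi.single 1 1 := by ext i; fin_cases i <;> simp [hlo, hhi]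
  have hsep : sepEdge lo hi = s(Λ.b - Pi.single 0 1, Λ.b) := by
    rw [hhilo, sepEdge_up]
    have hb0 := Λ.right
    congr 1
    · rw [Site.eq_iff_two]
      simp only [hlo, Pi.add_apply, Pi.sub_apply, single_zero_apply_zero, single_zero_apply_one,
        single_one_apply_zero, single_one_apply_one, Matrix.cons_val_zero, Matrix.cons_val_one]
      omega
    · rw [Site.eq_iff_two]
      simp only [hlo, Pi.add_apply, single_zero_apply_zero, single_zero_apply_one,
        single_one_apply_zero, single_one_apply_one, Matrix.cons_val_zero, Matrix.cons_val_one]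
      omega
  have hadj : (zdGraph 2).Adj lo hi := by rw [hhilo]; exact adj_of_stepKind (.up (by simp) (by simp))
  have hpair : s(g, f) = s(lo, hi) := sepEdge_injective hgf hadj (heq.trans hsep.symm)
  have hhiA : IsAboveFace M N ω₀ hi := Λ.isAboveFace_rightCol hM hT le_rfl hb.2.2.2
  rcases Sym2.eq_iff.1 hpair with ⟨rfl, -⟩ | ⟨rfl, rfl⟩
  · exact hg
  · exact absurd hg hhiA.not_mem_dualBelowR

/-- **No face of the right column strictly below the tip is an above face** (upward induction to
the below face just under the tip). [folklore] -/
theorem not_isAboveFace_rightCol_of_lt (hM : 1 ≤ M) (hT : ∀ t ∈ dualTopSide M N, t ∉ dualBelowR M N ω₀)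
    {y : ℤ} (hy : y < Λ.b 1) : ¬ IsAboveFace M N ω₀ ![(M : ℤ) - 1, y] := by
  have hb := mem_rectangle_iff.1 Λ.b_mem_rectangle
  obtain ⟨k, rfl⟩ : ∃ k : ℕ, y = Λ.b 1 - 1 - k := ⟨(Λ.b 1 - 1 - y).toNat, by omega⟩
  induction k with
  | zero =>
    intro hA
    have := Λ.mem_dualBelowR_below_tip hM hT
    simp only [Nat.cast_zero, sub_zero] at hA
    exact hA.not_mem_dualBelowR this
  | succ k ih =>
    intro hA
    have ih' := ih (by omega)
    set f : Site 2 := ![(M : ℤ) - 1, Λ.b 1 - 1 - ((k + 1 : ℕ) : ℤ)] with hf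
    set f' : Site 2 := ![(M : ℤ) - 1, Λ.b 1 - 1 - (k : ℕ)] with hf'
    have hff' : f' = f + Pi.single 1 1 := by
      rw [Site.eq_iff_two]
      simp only [hf, hf', Pi.add_apply, single_one_apply_zero, single_one_apply_one, Matrix.cons_val_zero,
        Matrix.cons_val_one, Nat.cast_add, Nat.cast_one]
      omega
    have hadj : (zdGraph 2).Adj f f' := by rw [hff']; exact adj_of_stepKind (.up (by simp) (by simp))
    have hfR := mem_dualRectangle_iff.1 hA.mem_dualRectangle
    simp only [hf, Matrix.cons_val_zero, Matrix.cons_val_one] at hfR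
    have hf'R : f' ∈ dualRectangle M N := by
      rw [mem_dualRectangle_iff]; simp [hf']; omega
    rcases hA.isAboveFace_or_mem_of_adj hadj hf'R with h | h
    · exact ih' h
    · -- `f'` below, `f` above: the edge between them is a low edge at `(M, b₁ - 1 - k)`
      have hle : IsLowEdge M N ω₀ (sepEdge f' f) := ⟨f', f, hadj.symm, h, hA, rfl⟩
      have hmem : (f' + Pi.single 0 1 : Site 2) ∈ sepEdge f' f := by
        rw [sepEdge_comm, hff', sepEdge_up]; exact Sym2.mem_mk_right _ _
      have hv : (f' + Pi.single 0 1 : Site 2) ∈ Λ.path.support :=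
        (Λ.mem_support_iff hM).2 ⟨_, hle, hmem⟩
      have h0 : (f' + Pi.single 0 1 : Site 2) 0 = M := by simp [hf']
      have heq : (f' + Pi.single 0 1 : Site 2) = Λ.b := by
        by_contra hne
        have := Λ.apply_zero_lt_of_ne hM hv hne
        omega
      have h1 : (f' + Pi.single 0 1 : Site 2) 1 = Λ.b 1 - 1 - k := by simp [hf']
      rw [heq] at h1
      omega

/-- **Right-side vertices strictly below the tip are not above vertices** (the face of `R*` at
their upper left would be above). [folklore] -/
theorem not_isAboveVertex_right_of_lt (hM : 1 ≤ M) (hT : ∀ t ∈ dualTopSide M N, t ∉ dualBelowR M N ω₀)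
    {w : Site 2} (hw0 : w 0 = M) (hy : w 1 < Λ.b 1) (hy0 : 0 ≤ w 1) : ¬ IsAboveVertex M N ω₀ w := by
  intro hA
  have hb := mem_rectangle_iff.1 Λ.b_mem_rectangle
  have hzR : (w - Pi.single 0 1 : Site 2) ∈ dualRectangle M N := by
    rw [mem_dualRectangle_iff]; simp [hw0]; omega
  have := hA.isAboveFace_of_corner (ZdCorner.NW_mem w) hzR
  have heq : (w - Pi.single 0 1 : Site 2) = ![(M : ℤ) - 1, w 1] := by ext i; fin_cases i <;> simp [hw0]
  rw [heq] at this
  exact Λ.not_isAboveFace_rightCol_of_lt hM hT hy this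

/-- Right-side vertices strictly below the tip are not on the lowest crossing either. [folklore] -/
theorem not_mem_support_right_of_lt (hM : 1 ≤ M) {w : Site 2} (hw0 : w 0 = M) (hy : w 1 < Λ.b 1) :
    w ∉ Λ.path.support := by
  intro hw
  have : w = Λ.b := by
    by_contra hne; have := Λ.apply_zero_lt_of_ne hM hw hne; omega
  rw [this] at hy; omega

/-! ### The chain lemma: an open walk from outside / above either stays above or hits `Λ` -/

/-- **Chain lemma.** Let `W` be a lattice walk whose vertices with `x₀ ≤ M` lie in `R`, which steps
from outside `R` onto the right side only strictly above the tip, and which starts outside `R`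
(`x₀ > M`) or at an above vertex.  Then either every vertex of `W` is outside `R` or an above
vertex, or an initial segment of `W` ends at a vertex of the lowest crossing `Λ` and has all its
other vertices outside `R` or above (a neighbour in `R` of an above vertex is above or on `Λ`,
`IsAboveVertex.of_adj`; a right-side vertex above the tip is above, `isAboveVertex_right`). [folklore] -/
theorem fresh_chain (hM : 1 ≤ M) (hT : ∀ t ∈ dualTopSide M N, t ∉ dualBelowR M N ω₀) {a b : Site 2}
    (W : (zdGraph 2).Walk a b) (hWR : ∀ w ∈ W.support, w 0 ≤ (M : ℤ) → w ∈ rectangle M N)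
    (hWin : ∀ d ∈ W.darts, (M : ℤ) < d.fst 0 → d.snd 0 ≤ M → Λ.b 1 < d.snd 1)
    (ha : (M : ℤ) < a 0 ∨ IsAboveVertex M N ω₀ a) :
    (∀ w ∈ W.support, (M : ℤ) < w 0 ∨ IsAboveVertex M N ω₀ w) ∨
      ∃ v ∈ Λ.path.support, ∃ P : (zdGraph 2).Walk a v, (∀ w ∈ P.support, w ∈ W.support) ∧
        (∀ e ∈ P.edges, e ∈ W.edges) ∧
        ∀ w ∈ P.support, w ≠ v → (M : ℤ) < w 0 ∨ IsAboveVertex M N ω₀ w := by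
  induction W with
  | nil =>
    refine Or.inl fun w hw => ?_
    rw [Walk.support_nil, List.mem_singleton] at hw
    rw [hw]; exact ha
  | cons h W' ih =>
    rename_i x y z
    by_cases hy : y ∈ Λ.path.support
    · refine Or.inr ⟨y, hy, Walk.cons h Walk.nil, fun w hw => ?_, fun e he => ?_, fun w hw hne => ?_⟩
      · rw [Walk.support_cons, Walk.support_nil, List.mem_cons, List.mem_singleton] at hw
        rcases hw with rfl | rfl
        · exact Walk.start_mem_support _
        · rw [Walk.support_cons]; exact List.mem_cons_of_mem _ W'.start_mem_support
      · rw [Walk.edges_cons, Walk.edges_nil, List.mem_singleton] at he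
        rw [he, Walk.edges_cons]; exact List.mem_cons_self
      · rw [Walk.support_cons, Walk.support_nil, List.mem_cons, List.mem_singleton] at hw
        rcases hw with rfl | rfl
        · exact ha
        · exact absurd rfl hne
    · have hy' : (M : ℤ) < y 0 ∨ IsAboveVertex M N ω₀ y := by
        by_cases hy0 : (M : ℤ) < y 0
        · exact Or.inl hy0
        rw [not_lt] at hy0
        have hyW : y ∈ (Walk.cons h W').support := by
          rw [Walk.support_cons]; exact List.mem_cons_of_mem _ W'.start_mem_support
        have hyR : y ∈ rectangle M N := hWR y hyW hy0
        refine Or.inr ?_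
        rcases ha with hx | hx
        · -- a step from outside `R` onto its right side, strictly above the tip
          have hd : (⟨(x, y), h⟩ : (zdGraph 2).Dart) ∈ (Walk.cons h W').darts := by
            rw [Walk.darts_cons]; exact List.mem_cons_self
          have h1 : Λ.b 1 < y 1 := hWin _ hd hx hy0
          have h0 : y 0 = M := by have := zdGraph_adj_apply_le h 0; omega
          exact Λ.isAboveVertex_right hM hT h0 h1 (mem_rectangle_iff.1 hyR).2.2.2
        · exact hx.of_adj hM hyR h fun hl => hy ((Λ.mem_support_iff hM).2 hl)
      rcases ih (fun w hw => hWR w (by rw [Walk.support_cons]; exact List.mem_cons_of_mem _ hw))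
          (fun d hd => hWin d (by rw [Walk.darts_cons]; exact List.mem_cons_of_mem _ hd)) hy' with
        hall | ⟨v, hv, P, hPs, hPe, hPf⟩
      · refine Or.inl fun w hw => ?_
        rw [Walk.support_cons, List.mem_cons] at hw
        rcases hw with rfl | hw
        · exact ha
        · exact hall w hw
      · refine Or.inr ⟨v, hv, Walk.cons h P, fun w hw => ?_, fun e he => ?_, fun w hw hne => ?_⟩
        · rw [Walk.support_cons, List.mem_cons] at hw ⊢
          rcases hw with rfl | hw
          · exact Or.inl rfl
          · exact Or.inr (hPs w hw)
        · rw [Walk.edges_cons, List.mem_cons] at he ⊢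
          rcases he with rfl | he
          · exact Or.inl rfl
          · exact Or.inr (hPe e he)
        · rw [Walk.support_cons, List.mem_cons] at hw
          rcases hw with rfl | hw
          · exact ha
          · exact hPf w hw hne

/-! ### Catching the tip -/

set_option maxHeartbeats 1600000 in
/-- **Tip catch (fence and upper extent from four crossings around the tip).**  Let `Λ` be the
lowest open left–right crossing of `R = [0,M] × [0,N]` in `ω₀`, with tip `z = Λ.b = (M, z₁)`,
`2ρ ≤ z₁`, `z₁ + 2ρ ≤ N`, `2ρ ≤ M`, `ρ ≥ 1`.  Suppose the lattice configuration `ω` contains open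
left–right crossings of `[M-2ρ, M+2ρ] × [z₁+ρ, z₁+2ρ]` and of `[M-2ρ, M+2ρ] × [z₁-2ρ, z₁-ρ]` and an
open top–bottom crossing of `[M-2ρ, M-ρ] × [z₁-2ρ, z₁+2ρ]`, and let `V` be any lattice walk inside
the columns `[M+ρ, M+2ρ]` from a row `≤ z₁ + ρ` to a row `≥ z₁ + 2ρ` (e.g. an open top–bottom
crossing of `[M+ρ, M+2ρ] × [z₁-3ρ, z₁+3ρ]`, the future fence).  Then some vertex `u` of `V` is
joined to a vertex `v` of `Λ` by an `ω`-open walk `P` inside `[M-2ρ, M+2ρ] × [z₁-2ρ, z₁+2ρ]` whose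
vertices other than `v` are outside `R` (`x₀ > M`) or above vertices of `Λ` (so that its edges are
"fresh": not read by the event that `Λ` is the lowest crossing), and whose vertices on the right
side `x₀ = M` all have height `≥ z₁ + ρ` (UPPER EXTENT: the open cluster of `Λ` in `R` reaches
the right side at height `≥ z₁ + ρ` through `P`).  This is the deterministic part of "the crossing
can be made well-separated / has a fence" (Nolin 2008, Def. 7 and Lemma 15 [arXiv Def. 6,
Lemma 14]; Kesten 1987, Lemma 4; Schramm–Steif 2010, Lemma A.2). [cite: Nolin2008, §4.4, Lemma 15 (arXiv 0711.4948: Lemma 14, p. 11)] -/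
theorem exists_tipCatch (hM : 1 ≤ M) (hT : ∀ t ∈ dualTopSide M N, t ∉ dualBelowR M N ω₀)
    (hω : ω ⊆ (zdGraph 2).edgeSet) {ρ : ℕ} (hρ : 1 ≤ ρ) (hρM : 2 * ρ ≤ M) (hlo : 2 * (ρ : ℤ) ≤ Λ.b 1)
    (hhi : Λ.b 1 + 2 * ρ ≤ N)
    (hHp : ω ∈ lrCrossingAt ![(M : ℤ) - 2 * ρ, Λ.b 1 + ρ] (4 * ρ) ρ)
    (hHm : ω ∈ lrCrossingAt ![(M : ℤ) - 2 * ρ, Λ.b 1 - 2 * ρ] (4 * ρ) ρ)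
    (hVl : ω ∈ tbCrossingAt' ![(M : ℤ) - 2 * ρ, Λ.b 1 - 2 * ρ] ρ (4 * ρ))
    {c d : Site 2} (V : (zdGraph 2).Walk c d)
    (hV : ∀ z ∈ V.support, (M : ℤ) + ρ ≤ z 0 ∧ z 0 ≤ M + 2 * ρ) (hc : c 1 ≤ Λ.b 1 + ρ)
    (hd : Λ.b 1 + 2 * ρ ≤ d 1) :
    ∃ u ∈ V.support, ∃ v ∈ Λ.path.support, ∃ P : (zdGraph 2).Walk u v,
      (∀ w ∈ P.support, (M : ℤ) - 2 * ρ ≤ w 0 ∧ w 0 ≤ M + 2 * ρ ∧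
        Λ.b 1 - 2 * ρ ≤ w 1 ∧ w 1 ≤ Λ.b 1 + 2 * ρ) ∧
      (∀ e ∈ P.edges, e ∈ ω) ∧
      (∀ w ∈ P.support, w ≠ v → (M : ℤ) < w 0 ∨ IsAboveVertex M N ω₀ w) ∧
      ∀ w ∈ P.support, w 0 = M → Λ.b 1 + ρ ≤ w 1 := by
  classical
  have hb := mem_rectangle_iff.1 Λ.b_mem_rectangle
  -- the three crossings as walks
  obtain ⟨xp, yp, Tp, hxp, hyp, hTps, hTpe⟩ := exists_walk_of_mem_lrCrossingAt hω hHp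
  obtain ⟨xm, ym, Tm, hxm, hym, hTms, hTme⟩ := exists_walk_of_mem_lrCrossingAt hω hHm
  obtain ⟨xl, yl, Tl, hxl, hyl, hTls, hTle⟩ := exists_walk_of_mem_tbCrossingAt hω hVl
  simp only [Matrix.cons_val_zero, Matrix.cons_val_one, Nat.cast_mul, Nat.cast_ofNat] at hxp hyp hTps hxm hym hTms hxl hyl hTls
  -- junction `j₁` of `H⁺` and `V^L`, junction `j₂` of `V^L` and `H⁻`, vertex `u` of `H⁺` on `V`
  obtain ⟨p₁, q₁, U₁, hp₁, hq₁, hU₁s, -⟩ :=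
    exists_segment_between 1 Tl (Λ.b 1 + ρ) (Λ.b 1 + 2 * ρ) (by omega) (by omega) (by omega)
  obtain ⟨j₁, hj₁U, hj₁p⟩ := exists_mem_support_of_hFence (L₀ := (M : ℤ) - 2 * ρ)
    (L₁ := (M : ℤ) - ρ) (B := Λ.b 1 + ρ) (B' := Λ.b 1 + 2 * ρ) Tp
    (fun z hz => by have := hTps z hz; exact ⟨by omega, by omega⟩) (by omega) (by omega) (by omega)
    U₁ hp₁ hq₁ (fun z hz => by
      have h₁ := hU₁s z hz; have h₂ := hTls z h₁.2.2; exact ⟨by omega, by omega, by omega, by omega⟩)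
  have hj₁l : j₁ ∈ Tl.support := (hU₁s j₁ hj₁U).2.2
  obtain ⟨p₂, q₂, U₂, hp₂, hq₂, hU₂s, -⟩ :=
    exists_segment_between 1 Tl (Λ.b 1 - 2 * ρ) (Λ.b 1 - ρ) (by omega) (by omega) (by omega)
  obtain ⟨j₂, hj₂U, hj₂m⟩ := exists_mem_support_of_hFence (L₀ := (M : ℤ) - 2 * ρ)
    (L₁ := (M : ℤ) - ρ) (B := Λ.b 1 - 2 * ρ) (B' := Λ.b 1 - ρ) Tm
    (fun z hz => by have := hTms z hz; exact ⟨by omega, by omega⟩) (by omega) (by omega) (by omega)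
    U₂ hp₂ hq₂ (fun z hz => by
      have h₁ := hU₂s z hz; have h₂ := hTls z h₁.2.2; exact ⟨by omega, by omega, by omega, by omega⟩)
  have hj₂l : j₂ ∈ Tl.support := (hU₂s j₂ hj₂U).2.2
  obtain ⟨p₀, q₀, S, hp₀, hq₀, hSs, -⟩ :=
    exists_segment_between 0 Tp ((M : ℤ) + ρ) ((M : ℤ) + 2 * ρ) (by omega) (by omega) (by omega)
  obtain ⟨u, huS, huV⟩ := exists_mem_support_of_vFence (L := (M : ℤ) + ρ) (R := (M : ℤ) + 2 * ρ)
    (B₀ := Λ.b 1 + ρ) (B₁ := Λ.b 1 + 2 * ρ) V hV hc hd (by omega) S hp₀ hq₀ (fun z hz => by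
      have h₁ := hSs z hz; have h₂ := hTps z h₁.2.2; exact ⟨by omega, by omega, by omega, by omega⟩)
  have hup : u ∈ Tp.support := (hSs u huS).2.2
  -- the walks to chain: `u → j₁` inside `H⁺`, `j₁ → j₂` inside `V^L`, `j₂ →` first visit of the
  -- right side inside `H⁻`
  obtain ⟨Wa, hWas, hWae⟩ := exists_walk_within_support Tp hup hj₁p
  obtain ⟨Wb, hWbs, hWbe⟩ := exists_walk_within_support Tl hj₁l hj₂l
  obtain ⟨Wc, hWcs, hWce⟩ := exists_walk_within_support Tm hj₂m Tm.end_mem_support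
  obtain ⟨q₃, U₃, hq₃, hU₃s, hU₃e, hU₃d⟩ :=
    exists_prefix_reach_ge_sharp 0 Wc (M : ℤ) (by have := hTls j₂ hj₂l; omega) (by omega)
  have hRa : ∀ w ∈ Wa.support, w 0 ≤ (M : ℤ) → w ∈ rectangle M N := fun w hw hw0 => by
    have := hTps w (hWas w hw); rw [mem_rectangle_iff]; omega
  have hRb : ∀ w ∈ Wb.support, w 0 ≤ (M : ℤ) → w ∈ rectangle M N := fun w hw _ => by
    have := hTls w (hWbs w hw); rw [mem_rectangle_iff]; omega
  have hRc : ∀ w ∈ U₃.support, w 0 ≤ (M : ℤ) → w ∈ rectangle M N := fun w hw hw0 => by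
    have := hTms w (hWcs w (hU₃s w hw).2); rw [mem_rectangle_iff]; omega
  -- chain 1: along `H⁺`
  rcases Λ.fresh_chain hM hT Wa hRa (fun d hd _ _ => by
      have := hTps _ (hWas _ (Wa.dart_snd_mem_support_of_mem_darts hd)); omega)
      (Or.inl (by have := hV u huV; omega)) with hallA | ⟨v, hv, P, hPs, hPe, hPf⟩
  swap
  · refine ⟨u, huV, v, hv, P, fun w hw => ?_, fun e he => hTpe e (hWae e (hPe e he)), hPf,
      fun w hw _ => ?_⟩
    · have := hTps w (hWas w (hPs w hw)); omega
    · have := hTps w (hWas w (hPs w hw)); omega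
  -- chain 2: down `V^L`
  rcases Λ.fresh_chain hM hT Wb hRb (fun d hd h1 _ => absurd h1 (by
      have := hTls _ (hWbs _ (Wb.dart_fst_mem_support_of_mem_darts hd)); omega))
      (hallA j₁ Wa.end_mem_support) with hallB | ⟨v, hv, P, hPs, hPe, hPf⟩
  swap
  · refine ⟨u, huV, v, hv, Wa.append P, fun w hw => ?_, fun e he => ?_, fun w hw hne => ?_,
      fun w hw hw0 => ?_⟩
    · rw [Walk.mem_support_append_iff] at hw
      rcases hw with hw | hw
      · have := hTps w (hWas w hw); omega
      · have := hTls w (hWbs w (hPs w hw)); omega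
    · rw [Walk.edges_append, List.mem_append] at he
      rcases he with he | he
      · exact hTpe e (hWae e he)
      · exact hTle e (hWbe e (hPe e he))
    · rw [Walk.mem_support_append_iff] at hw
      rcases hw with hw | hw
      · exact hallA w hw
      · exact hPf w hw hne
    · rw [Walk.mem_support_append_iff] at hw
      rcases hw with hw | hw
      · have := hTps w (hWas w hw); omega
      · have := hTls w (hWbs w (hPs w hw)); omega
  -- chain 3: along `H⁻` up to its first visit of the right side, which is impossible to reach
  rcases Λ.fresh_chain hM hT U₃ hRc (fun d hd h1 _ => absurd h1 (by have := hU₃d d hd; omega))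
      (hallB j₂ Wb.end_mem_support) with hallC | ⟨v, hv, P, hPs, hPe, hPf⟩
  · exfalso
    have h3 := hU₃s q₃ U₃.end_mem_support
    have := hTms q₃ (hWcs q₃ h3.2)
    rcases hallC q₃ U₃.end_mem_support with h | h
    · omega
    · exact Λ.not_isAboveVertex_right_of_lt hM hT hq₃ (by omega) (by omega) h
  · refine ⟨u, huV, v, hv, Wa.append (Wb.append P), fun w hw => ?_, fun e he => ?_,
      fun w hw hne => ?_, fun w hw hw0 => ?_⟩
    · rw [Walk.mem_support_append_iff, Walk.mem_support_append_iff] at hw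
      rcases hw with hw | hw | hw
      · have := hTps w (hWas w hw); omega
      · have := hTls w (hWbs w hw); omega
      · have := hTms w (hWcs w (hU₃s w (hPs w hw)).2); omega
    · rw [Walk.edges_append, List.mem_append, Walk.edges_append, List.mem_append] at he
      rcases he with he | he | he
      · exact hTpe e (hWae e he)
      · exact hTle e (hWbe e he)
      · exact hTme e (hWce e (hU₃e e (hPe e he)))
    · rw [Walk.mem_support_append_iff, Walk.mem_support_append_iff] at hw
      rcases hw with hw | hw | hw
      · exact hallA w hw
      · exact hallB w hw
      · exact hPf w hw hne
    · rw [Walk.mem_support_append_iff, Walk.mem_support_append_iff] at hw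
      rcases hw with hw | hw | hw
      · have := hTps w (hWas w hw); omega
      · have := hTls w (hWbs w hw); omega
      · have hwm := hTms w (hWcs w (hU₃s w (hPs w hw)).2)
        exfalso
        by_cases hwv : w = v
        · -- `v` on `Λ` at the right side is the tip, whose height is `z₁ > z₁ - ρ`
          subst hwv
          by_cases hvb : w = Λ.b
          · rw [hvb] at hwm; omega
          · have := Λ.apply_zero_lt_of_ne hM hv hvb; omega
        · rcases hPf w hw hwv with h | h
          · omega
          · exact Λ.not_isAboveVertex_right_of_lt hM hT hw0 (by omega) (by omega) h

end LowPath

end Literature.Probability.Percolation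

end
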